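import Literature.MathematicalPhysics.QuantumFieldTheory.Balaban1983to89.T4AvgDerivBound

/-!
# T⁴ programme, spine node NE1′ (O3b/H2), COUPLING LINE — leaf L5 (group level) of the skeleton
# `t4/skeletons/NE1p-t4-ne1p-p3.md` (v0.6): the displacement `hol(U′)·hol(U)⁻¹` of a holonomy between the dressed and the
# undressed configuration is the ordered product of the ONE-BOND QUOTIENTS `U′_b U_b⁻¹` TRANSPORTED (conjugated) by the
# unperturbed partial holonomies; the quotients are CONJUGATION-EQUIVARIANT under gauge transformations — also for the
# quotients of `n`-fold averages, by [Balaban1985Averaging] (11) —, and their size is the tree's one-bond size `bdist`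

Cell `pub-balaban`, unit `b2b-balaban-t4-ne1p-p3` (ROUND-2 technique-distinct prover #3 on BINDER row NE1′, technique «coupling of
block-spin towers: run the dressed and undressed towers on one probability space and bound the difference pathwise»), generation 30;
item (m1) of the division of labour agreed with road P4 (`t4-ne1p-p4`, journal l.5166/5175/5206); companion of
`Support/NE1pCouplingStructure` (the LINEAR level: first-order expansion, covectors, quadratic remainder).  This file is OUR
elementary bookkeeping (new work ⇒ `Summits/`), not a published statement; everything is PROVED, nothing is a `def … : Prop`.

HONEST FRAMING (T4-DAG p. 1).  Rung (B)+1 on ONE finite four-torus of fixed physical size; NOT infinite volume, NOT a mass gap,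
NOT the Clay problem, NOT summit progress.  Nothing of T. Bałaban's series is asserted here.  The only contact with the series is
the tree AXIOM `Setup.Averaging.covariant` — [Balaban1985Averaging] (11) p. 19 «we demand that the averaging preserves gauge
transformations, i.e. \overline{U^u} = (Ū)^u», iterated in the tree as `T4AvgSensitivity.iterFrom_gaugeAct` — used BY NAME to
transport the equivariance of the one-bond quotients up the averaging tower (`quot_iterFrom_gaugeAct`).  HONEST DEPENDENCY
(verbatim): continuum YM on T⁴ ⇐ BetaPertH ∧ nine spine estimates (0/9 proved); BetaPertH ⇐ (D1) ∧ (D4) ∧ CAP+tail; G-an2-4 gates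
asym, D1 and NE2/3/4.

WHAT IS PROVED (tree vocabulary `Setup` / `T4Continuum` / `T4AvgSensitivity` / `T4AvgDerivBound`; any group `G`).
* `gprod_mul_gprod_inv`, `prod_mul_prod_inv_eq_quotProd`, `holAt_mul_holAt_inv` — TRANSPORT IDENTITY: the displacement
  `(∏ a)·(∏ b)⁻¹` of an ordered product / `holAt U′ γ · (holAt U γ)⁻¹` of the holonomy `T4Continuum.holAt` along ANY step sequence
  is the ordered product of the ONE-STEP quotients conjugated by the UNPERTURBED partial products (exact; «`Ad`-transport» at group
  level — the skeleton's «derivative of the averaged loop = Ad-TRANSPORT of the bond perturbation», here before linearisation);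
* `quot_gaugeAct`, `quot_inv_gaugeAct`, `quot_iterFrom_gaugeAct` — EQUIVARIANCE: under a gauge transformation `u`
  ([Balaban1985Averaging] (8), tree `GaugeField.gaugeAct`) the quotient `U′(b)U(b)⁻¹` is CONJUGATED by `u(b₋)` (a group-valued
  «vector at `b₋`», not an invariant); for the quotients at a coarse bond `ℓ` of the `n`-fold averages of two level-`k`
  configurations the conjugating element is the pushed-up transformation `transfUpFrom u n (ℓ₋)`;
* `dist1_quot_eq_bdist`, `dist1_quot_gaugeAct` — SIZE: `dist1 (U′(b)U(b)⁻¹) = bdist (U b) (U′ b)`, gauge invariant — so the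
  skeleton's pathwise rate L3 (the printed `θ₁ = L^{1−d}`, [Balaban1985Averaging] Prop. 5 (156) with (138), typed in the tree as
  `T4AvgDerivBound.LoopDerivBound` / `AvgStepContraction`, NOT discharged here or anywhere) is a bound on exactly these quotients.
NOT PROVED, NOT CLAIMED: any estimate; anything about Bałaban's concrete averaging (14)/(15) beyond the axiom (11); the Lie-algebra
reading (`log` of the quotient = the displacement VECTOR `θ₁ⁿ𝒱` of the skeleton) — that is the companion file's abstract §2.
-/

namespace Summit.QuantumFields.BalabanUV.T4Continuum.NE1pDisplacementTransport

/-! ## §1 Group level: transport identity, gauge equivariance and size of the one-bond displacement quotients -/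

section GroupLevel

variable {G : Type*} [Group G]

/-- The ordered product `a 0 · a 1 ⋯ a (m−1)` of a sequence in a group (`List.prod` over `List.range`). [folklore] -/
def gprod (a : ℕ → G) (m : ℕ) : G := ((List.range m).map a).prod

/-- Empty product. [folklore] -/
@[simp] theorem gprod_zero (a : ℕ → G) : gprod a 0 = 1 := by simp [gprod]

/-- One more factor on the right. [folklore] -/
theorem gprod_succ (a : ℕ → G) (m : ℕ) : gprod a (m + 1) = gprod a m * a m := List.prod_range_succ a m

/-- **TRANSPORT IDENTITY** (indexed form).  The displacement `(∏ a)·(∏ b)⁻¹` of an ordered product is the ordered product of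
the ONE-STEP quotients `a_i b_i⁻¹`, each CONJUGATED («transported») by the UNPERTURBED partial product `b₀⋯b_{i−1}` — exact, in
any group. [folklore] -/
theorem gprod_mul_gprod_inv (a b : ℕ → G) (m : ℕ) :
    gprod a m * (gprod b m)⁻¹ = gprod (fun i => gprod b i * (a i * (b i)⁻¹) * (gprod b i)⁻¹) m := by
  induction m with
  | zero => simp
  | succ m ih =>
    rw [gprod_succ, gprod_succ, gprod_succ, ← ih]
    group

/-- The NESTED form of the transported quotient product of a list of (perturbed, unperturbed) pairs:
`q₀ · b₀ (q₁ · b₁ (q₂ ⋯) b₁⁻¹) b₀⁻¹`, `q_i = a_i b_i⁻¹`. [folklore] -/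
def quotProd : List (G × G) → G
  | [] => 1
  | p :: t => p.1 * p.2⁻¹ * (p.2 * quotProd t * p.2⁻¹)

/-- **TRANSPORT IDENTITY** (list form): `(∏ firsts)·(∏ seconds)⁻¹ = quotProd`. [folklore] -/
theorem prod_mul_prod_inv_eq_quotProd :
    ∀ l : List (G × G), (l.map Prod.fst).prod * ((l.map Prod.snd).prod)⁻¹ = quotProd l
  | [] => by simp [quotProd]
  | p :: t => by
    rw [List.map_cons, List.map_cons, List.prod_cons, List.prod_cons, quotProd, ← prod_mul_prod_inv_eq_quotProd t]
    group

end GroupLevel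

section Gauge

open Literature.MathematicalPhysics.QuantumFieldTheory.Balaban1983to89
open Literature.MathematicalPhysics.QuantumFieldTheory.Balaban1983to89.T4Continuum
open Literature.MathematicalPhysics.QuantumFieldTheory.Balaban1983to89.T4AvgSensitivity
open Literature.MathematicalPhysics.QuantumFieldTheory.Balaban1983to89.T4AvgDerivBound

variable {P : Params} {j : ℕ} {G : Type*} [GaugeGroup G]

/-- The value of one oriented step under a configuration: `U(b)` forward, `U(b)⁻¹` backward (the factor of `T4Continuum.holAt`).
[folklore] -/
def stepVal (U : GaugeField P j G) (s : LStep P j) : G := if s.fwd then U s.bond else (U s.bond)⁻¹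

/-- `holAt` is the ordered product of the step values (definitional). [folklore] -/
theorem holAt_eq_prod_stepVal (U : GaugeField P j G) (γ : List (LStep P j)) :
    holAt U γ = (γ.map (stepVal U)).prod := rfl

/-- **TRANSPORT IDENTITY FOR HOLONOMIES**: along any step sequence, `hol(U′)·hol(U)⁻¹` is the nested product of the one-step
quotients `stepVal U′ s · (stepVal U s)⁻¹` transported by the unperturbed step values (`quotProd`). [folklore] -/
theorem holAt_mul_holAt_inv (U U' : GaugeField P j G) (γ : List (LStep P j)) :
    holAt U' γ * (holAt U γ)⁻¹ = quotProd (γ.map fun s => (stepVal U' s, stepVal U s)) := by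
  rw [← prod_mul_prod_inv_eq_quotProd, List.map_map, List.map_map]
  rfl

/-- **EQUIVARIANCE OF THE ONE-BOND QUOTIENT**: under a gauge transformation `u` ([Balaban1985Averaging] (8):
`U^u(b) = u(b₋)U(b)u(b₊)⁻¹`, tree `GaugeField.gaugeAct`) the quotient `U′(b)U(b)⁻¹` of two configurations is CONJUGATED by
`u(b₋)` — it is a group-valued «vector at `b₋`», not an invariant. [folklore] -/
theorem quot_gaugeAct (u : GaugeTransf P j G) (U U' : GaugeField P j G) (b : PBond P j) :
    GaugeField.gaugeAct u U' b * (GaugeField.gaugeAct u U b)⁻¹ = u b.src * (U' b * (U b)⁻¹) * (u b.src)⁻¹ := by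
  simp only [GaugeField.gaugeAct]
  group

/-- The backward-step quotient is conjugated by `u(b₊)`. [folklore] -/
theorem quot_inv_gaugeAct (u : GaugeTransf P j G) (U U' : GaugeField P j G) (b : PBond P j) :
    (GaugeField.gaugeAct u U' b)⁻¹ * GaugeField.gaugeAct u U b = u b.tgt * ((U' b)⁻¹ * U b) * (u b.tgt)⁻¹ := by
  simp only [GaugeField.gaugeAct]
  group

/-- **EQUIVARIANCE UP THE AVERAGING TOWER**: for two level-`k` configurations `V, V′` and their `n`-fold averages
(`T4AvgSensitivity.iterFrom`), a gauge transformation `u` of level `k` conjugates the coarse one-bond quotient at `ℓ` by the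
pushed-up transformation `transfUpFrom u n (ℓ₋)` — [Balaban1985Averaging] (11) p. 19 iterated (tree `iterFrom_gaugeAct`, an
AXIOM of `Setup.Averaging`; in the standing range `k + n ≤ m + K`). [cite: Balaban1985Averaging, (11) p.19] -/
theorem quot_iterFrom_gaugeAct (av : ∀ i, Averaging P i G) {k : ℕ} (u : GaugeTransf P k G) (n : ℕ)
    (hn : k + n ≤ P.m + P.K) (V V' : GaugeField P k G) (ℓ : PBond P (k + n)) :
    iterFrom av k n (GaugeField.gaugeAct u V') ℓ * (iterFrom av k n (GaugeField.gaugeAct u V) ℓ)⁻¹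
      = transfUpFrom u n ℓ.src * (iterFrom av k n V' ℓ * (iterFrom av k n V ℓ)⁻¹) * (transfUpFrom u n ℓ.src)⁻¹ := by
  rw [iterFrom_gaugeAct av u n hn V', iterFrom_gaugeAct av u n hn V]
  exact quot_gaugeAct _ _ _ _

/-- **SIZE OF THE QUOTIENT = THE TREE'S ONE-BOND SIZE**: `dist1 (U′(b)U(b)⁻¹) = bdist (U b) (U′ b)` (`T4AvgDerivBound.bdist g h =
dist1 (g⁻¹h)`, conjugation invariance of `dist1`). [folklore] -/
theorem dist1_quot_eq_bdist (U U' : GaugeField P j G) (b : PBond P j) :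
    dist1 (U' b * (U b)⁻¹) = bdist (U b) (U' b) := by
  rw [bdist_def]
  have e : U' b * (U b)⁻¹ = U b * ((U b)⁻¹ * U' b) * (U b)⁻¹ := by group
  rw [e, GaugeGroup.dist1_conj]

/-- The size of the quotient is gauge invariant. [folklore] -/
theorem dist1_quot_gaugeAct (u : GaugeTransf P j G) (U U' : GaugeField P j G) (b : PBond P j) :
    dist1 (GaugeField.gaugeAct u U' b * (GaugeField.gaugeAct u U b)⁻¹) = dist1 (U' b * (U b)⁻¹) := by
  rw [quot_gaugeAct, GaugeGroup.dist1_conj]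

end Gauge

end Summit.QuantumFields.BalabanUV.T4Continuum.NE1pDisplacementTransport
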